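import Literature.AlgebraicGeometry.Frobenioids.ArchimedeanTheoremsInstances
import Literature.AlgebraicGeometry.Frobenioids.ArchimedeanAngularIstr
import HarnessLib

/-!
# Frobenioids II, Theorem 3.6 (ii), first clause at the angular Frobenioid `A` — the instance
# statement `ArchFrd.Thm36ii_istrBaseTrivial_A` closed AT ITS EXACT TYPE

Mochizuki, *The geometry of Frobenioids II*, Kyushu J. Math. **62** (2008) 401–460, §3, Theorem 3.6
(ii), author's kurims text p. 37 [cite: MochizukiFrdII2008, Thm 3.6 (ii) p.37]: "The Frobenioid
`A^istr` is of base-trivial and model type …".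

PROOF-ONLY companion of `ArchimedeanTheoremsInstances.lean` (statement file, seat abc-iut-L1-t9; never
edited here). The instance statement `ArchFrd.Thm36ii_istrBaseTrivial_A π := Thm36ii_istrBaseTrivial
(A.toElem π)` (FACT-LIST row F-0873) is PROVED in the tree by `ArchFrd.thm36ii_istrBaseTrivial_A`
(`ArchimedeanAngularIstr.lean`, seat abc-iut-L1-t9), whose type is the generic predicate at the
`A`-instance — definitionally the row's declaration, but not syntactically headed by it, so the
FACT-LIST `_holds` matcher records a name collision instead of a proof. This file states the closer
with the fully-qualified head of the row, over every base `π : D ⥤ D₀` (the universal closure of the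
row), so the row is consumable BY NAME as a theorem. No statement of the paper is strengthened or
weakened; typed ≠ proved applies to nothing here — this is a kernel proof; no side is taken on
[IUTchIII] Cor. 3.12.
-/

namespace Literature.AlgebraicGeometry.Frobenioids

open CategoryTheory

universe v u

namespace ArchFrd

variable {D : Type u} [Category.{v} D] (π : D ⥤ D0)

/-- **[FrdII] Theorem 3.6 (ii), first clause, for the angular Frobenioid `A` of Example 3.3 (iii)**
(FACT-LIST F-0873, exact-type closer): `A^istr` is of base-trivial type, over any base `π : D ⥤ D₀`.
One-line re-heading of `ArchFrd.thm36ii_istrBaseTrivial_A`. [cite: MochizukiFrdII2008, Thm 3.6 (ii) p.37] -/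
theorem thm36ii_istrBaseTrivial_A_holds :
    Literature.AlgebraicGeometry.Frobenioids.ArchFrd.Thm36ii_istrBaseTrivial_A π :=
  thm36ii_istrBaseTrivial_A π

/-- `Thm36ii_istrBaseTrivial_A` — `_holds` alias of `thm36ii_istrBaseTrivial_A_holds` above under the fact's exact name (appended
2026-08-28, D-0026 bookkeeping: the proof term is the existing theorem of this file; no statement,
definition or attribute is edited; no new named fact; the ledger's debt table listed the fact
unproved). [cite: MochizukiFrdII2008, Thm 3.6 (ii) p.37] -/
theorem _root_.Literature.AlgebraicGeometry.Frobenioids.ArchFrd.Thm36ii_istrBaseTrivial_A_holds :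
    Literature.AlgebraicGeometry.Frobenioids.ArchFrd.Thm36ii_istrBaseTrivial_A π :=
  _root_.Literature.AlgebraicGeometry.Frobenioids.ArchFrd.thm36ii_istrBaseTrivial_A_holds (π := π)

/-- The universal closure of FACT-LIST row F-0873 as a closed proposition: for every base category `D`
and every base functor `π : D ⥤ D₀`, `ArchFrd.Thm36ii_istrBaseTrivial_A π` holds.
[cite: MochizukiFrdII2008, Thm 3.6 (ii) p.37] -/
theorem forall_thm36ii_istrBaseTrivial_A :
    ∀ {D : Type u} [Category.{v} D] (π : D ⥤ D0),
      Literature.AlgebraicGeometry.Frobenioids.ArchFrd.Thm36ii_istrBaseTrivial_A π :=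
  fun π => thm36ii_istrBaseTrivial_A π

end ArchFrd

end Literature.AlgebraicGeometry.Frobenioids
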